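import Literature.Topology.FourManifolds.CircleSurgery
import Literature.Topology.FourManifolds.SectionCircleNbhd
import Literature.Topology.FourManifolds.CircleSurgeryExistence
import Literature.Topology.FourManifolds.GluingUniqueness
import Literature.Topology.FourManifolds.CircleNormalFraming
import Literature.Topology.FourManifolds.NormalFramingOfCircle
import HarnessLib

/-!
# Existence of Cappell–Shaneson spheres: decomposition of `Literature.Topology.FourManifolds.exists_isCappellShanesonSphereOf`

This file hosts the proof architecture (and, as they land, the proofs) of the named fact
`Literature.Topology.FourManifolds.exists_isCappellShanesonSphereOf` of `Literature.Topology.FourManifolds.CircleSurgery`: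
*for every `A ∈ SL(3, ℤ)` with `det (A - 1) = ±1` there is a closed smooth 4-manifold `X` with
`IsCappellShanesonSphereOf A X`* (Cappell–Shaneson, *Some new four-manifolds*, Ann. of Math. 104
(1976), §2; Gompf, *More Cappell–Shaneson spheres are standard*, Algebr. Geom. Topol. 10 (2010), §2:
"Let `X_φ` be the mapping torus `ℝ × M/(t, x) ∼ (t − 1, φ(x))`. Then `ℝ × {p}` descends to a circle
`C ⊂ X_φ` with a canonical framing. For `ε = 0, 1` let `X_φ^ε` be obtained from `X_φ` by surgery on `C`
with the canonical (`ε = 0`) or the noncanonical (`ε = 1`) framing. The Cappell–Shaneson examples arise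
when `M` is the 3-torus, so `φ` is obtained from some `A ∈ SL(3, ℤ)`").

The construction has two independent halves, vendored here as named facts, and the target fact is
*proved* from them (`Literature.Topology.FourManifolds.exists_isCappellShanesonSphereOf_of`):

* `Literature.Topology.FourManifolds.exists_mappingTorus_sectionCircleNbhd` — the **input of the surgery**: for every
  `A ∈ SL(3, ℤ)` there is a closed smooth 4-manifold `T` which is an open gluing, with explicit
  witnesses `jA`, `jB`, of the cylinders `T³ × (0, 1)` and `T³ × (1/2, 3/2)` along
  `mappingTorusRel (torusDiffeomorph A)` (a smooth mapping torus of the linear diffeomorphism `A` of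
  `T³`), together with a smoothly embedded circle `c : 𝕊¹ → T` whose image is the section
  `jA ({1} × (0, 1)) ∪ jB ({1} × (1/2, 3/2))` through the fixed point `1 ∈ T³`, and a tubular
  neighbourhood `𝕊¹ × ℝ³ ↪ T` of `c` (`CircleNbhd`; the normal bundle of the section is the mapping
  torus of `T_1 T³ = ℝ³` under `dA = A ∈ SL(3, ℝ)`, trivialised by a path from `1` to `A` in the
  connected group `SL(3, ℝ)` — Gompf 2010, §3: "by straightening the corresponding linear
  diffeomorphism of `T³` to the identity near `0`") (Cappell–Shaneson 1976, §2; Gompf 2010, §§2–3).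
* `Literature.Topology.FourManifolds.exists_isOpenGluing_circleSurgeryRel` — **surgery along a given tubular neighbourhood
  exists**: for every closed smooth 4-manifold `X` and every tubular neighbourhood
  `ν : 𝕊¹ × ℝ³ ↪ X` of a circle `c`, there is a closed smooth 4-manifold `P` which is an open gluing
  of `X ∖ c(𝕊¹)` and `D̊² × 𝕊²` along `circleSurgeryRel ν`, i.e.
  `P = (X ∖ ν(𝕊¹ × B³)) ∪_{𝕊¹ × 𝕊²} (D² × 𝕊²)` (Gompf–Stipsicz, *4-Manifolds and Kirby Calculus*
  (1999), §5.2; Kosinski, *Differential Manifolds* (1993), VI.1–2). No orientability hypothesis is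
  needed here: the framing is part of the datum `ν`.

Both are existence-of-a-construction statements which Mathlib cannot yet express as
constructions (no pushouts/gluings of charted spaces, no mapping tori as manifolds:
`Mathlib/Geometry/Manifold/Instances/Quotient.lean` leaves `IsManifold` of orbit spaces as a TODO);
they are discharged bottom-up in sibling files (generic open-gluing construction, then the two
instances). `Literature.Topology.FourManifolds.exists_isCircleSurgery` of the source file is the composite of
`nonempty_circleNbhd` (orientable case) with `exists_isOpenGluing_circleSurgeryRel`
(`Literature.Topology.FourManifolds.exists_isCircleSurgery_of`). The file also hosts the discharge
`nonempty_circleNbhd_holds` of `Literature.Topology.FourManifolds.nonempty_circleNbhd` itself (all orientable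
`X`, via the normal framing of `NormalFramingOfCircle.lean`).

Sources: S. Cappell, J. Shaneson, *Some new four-manifolds*, Ann. of Math. 104 (1976), 61–72, §2;
R. Gompf, *More Cappell–Shaneson spheres are standard*, Algebr. Geom. Topol. 10 (2010), §§2–3;
R. Gompf, A. Stipsicz, *4-Manifolds and Kirby Calculus* (1999), §5.2; A. Kosinski, *Differential
Manifolds* (1993), VI.1–2.
-/

open scoped Manifold ContDiff Topology
open Set

noncomputable section

namespace Literature.Topology.FourManifolds

/-- Local notation: `𝔼 n` is the model Euclidean space `EuclideanSpace ℝ (Fin n)`. -/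
local notation "𝔼 " n:arg => EuclideanSpace ℝ (Fin n)

/-- Local notation: `𝕊 n` is the unit sphere in `EuclideanSpace ℝ (Fin (n + 1))`. -/
local notation "𝕊 " n:arg => (Metric.sphere (0 : EuclideanSpace ℝ (Fin (n + 1))) 1)

/-- Local notation: the model with corners `𝓣 = (𝓡 1).prod ((𝓡 1).prod (𝓡 1))` of `ThreeTorus`. -/
local notation "𝓣" =>
  (ModelWithCorners.prod (𝓡 1) (ModelWithCorners.prod (𝓡 1) (𝓡 1)))

universe u

/-- **Mapping torus of a linear automorphism of `T³`, with its section circle and a tubular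
neighbourhood of it** (the input of the Cappell–Shaneson surgery). For every `A ∈ SL(3, ℤ)` there
are: a closed (compact, Hausdorff, second countable) smooth 4-manifold `T` charted on `ℝ⁴`; open
smooth embeddings `jA : T³ × (0, 1) → T`, `jB : T³ × (1/2, 3/2) → T` exhibiting `T` as the open
gluing along `mappingTorusRel (torusDiffeomorph A)` (`IsOpenGluingWith`), i.e. as the smooth
mapping torus `T³ × ℝ / (x, t) ∼ (A x, t + 1)`; a smooth embedding `c : 𝕊¹ → T` with image the
section `jA ({1} × (0, 1)) ∪ jB ({1} × (1/2, 3/2))` through the fixed point `1` of `A`; and a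
tubular neighbourhood `𝕊¹ × ℝ³ ↪ T` of `c` (`CircleNbhd`), which exists because the normal bundle
of the section is the mapping torus of `ℝ³` under `A ∈ SL(3, ℝ)` and `SL(3, ℝ)` is connected
(Cappell–Shaneson, Ann. of Math. 104 (1976), §2: "`ℝ × {p}` descends to a circle `C ⊂ X_φ` with a
canonical framing", in the words of Gompf, Algebr. Geom. Topol. 10 (2010), §2, and §3: the linear
diffeomorphism of `T³` is "straightened to the identity near `0`"). No condition on `det (A - 1)`
is needed for this part. [cite: CappellShaneson1976, §2 (construction: mapping torus of A ∈ SL(3,ℤ) on T³ and the framed section circle)] -/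
def exists_mappingTorus_sectionCircleNbhd : Prop :=
  ∀ A : Matrix.SpecialLinearGroup (Fin 3) ℤ,
    ∃ (T : Type) (_ : TopologicalSpace T) (_ : T2Space T) (_ : SecondCountableTopology T)
      (_ : CompactSpace T) (_ : ChartedSpace (𝔼 4) T) (_ : IsManifold (𝓡 4) ∞ T)
      (jA : ThreeTorus × ↥mappingTorusPieceOne → T) (jB : ThreeTorus × ↥mappingTorusPieceTwo → T),
      IsOpenGluingWith (ModelWithCorners.prod 𝓣 𝓘(ℝ, ℝ))
          (ModelWithCorners.prod 𝓣 𝓘(ℝ, ℝ)) (𝓡 4)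
          (mappingTorusRel ⇑(torusDiffeomorph A)) jA jB ∧
        ∃ c : 𝕊 1 → T, Manifold.IsSmoothEmbedding (𝓡 1) (𝓡 4) ∞ c ∧
          Set.range c = jA '' ({1} ×ˢ Set.univ) ∪ jB '' ({1} ×ˢ Set.univ) ∧
          Nonempty (CircleNbhd (𝓡 4) c)

/-- **Circle surgery along a given tubular neighbourhood exists.** Let `X` be a closed (compact,
Hausdorff, second countable) smooth 4-manifold, `c : 𝕊¹ → X` and `ν : 𝕊¹ × ℝ³ ↪ X` a tubular
neighbourhood of `c` (`CircleNbhd`: an open smooth embedding with `ν (u, 0) = c u`). Then there is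
a closed smooth 4-manifold `P` which is the open gluing of `X ∖ c(𝕊¹)` and `D̊² × 𝕊²` along
`circleSurgeryRel ν` (`ν (u, t • v) ∼ (t • u, v)`, `0 < t < 1`), i.e.
`P = (X ∖ ν(𝕊¹ × B³)) ∪_{𝕊¹ × 𝕊²} (D² × 𝕊²)` is obtained from `X` by surgery on `c` with the framing
`ν`. (`P` is the pushout; it is Hausdorff because the graph of the gluing diffeomorphism
`ν(u, w) ↦ (‖w‖ • u, w / ‖w‖)`, `0 < ‖w‖ < 1`, is closed in `(X ∖ c) × (D̊² × 𝕊²)`, and compact as the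
union of the images of the compact sets `X ∖ ν(𝕊¹ × B³_{1/2})` and `D²_{1/2} × 𝕊²`.) The framing,
hence any orientability discussion, is entirely contained in the datum `ν`
(Gompf–Stipsicz, *4-Manifolds and Kirby Calculus* (1999), §5.2; Kosinski, *Differential
Manifolds* (1993), VI.1–2). [cite: GompfStipsicz1999, §5.2 (surgery on an embedded circle with a chosen framing)] -/
def exists_isOpenGluing_circleSurgeryRel : Prop :=
  ∀ {X : Type u} [TopologicalSpace X] [T2Space X] [SecondCountableTopology X] [CompactSpace X]
    [ChartedSpace (𝔼 4) X] [IsManifold (𝓡 4) ∞ X] {c : 𝕊 1 → X} (ν : CircleNbhd (𝓡 4) c),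
    ∃ (P : Type u) (_ : TopologicalSpace P) (_ : T2Space P) (_ : SecondCountableTopology P)
      (_ : ChartedSpace (𝔼 4) P) (_ : IsManifold (𝓡 4) ∞ P) (_ : CompactSpace P),
      IsOpenGluing (𝓡 4) (𝓘(ℝ, 𝔼 2).prod (𝓡 2)) (𝓡 4) (A := ν.complement) (B := ↥discTimesSphere)
        (P := P) (circleSurgeryRel ν)

/-- **Assembly of the Cappell–Shaneson construction.** The named fact
`exists_isCappellShanesonSphereOf` follows from its two halves: take the mapping torus `T` of
`torusDiffeomorph A` with its gluing witnesses, section circle `c` and tubular neighbourhood `ν`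
(`exists_mappingTorus_sectionCircleNbhd`), and do surgery along `ν`
(`exists_isOpenGluing_circleSurgeryRel`); the result `X` is a closed smooth 4-manifold with
`IsCappellShanesonSphereOf A X` by definition of the latter (Cappell–Shaneson 1976, §2). [cite: CappellShaneson1976, §2] -/
theorem exists_isCappellShanesonSphereOf_of (hT : exists_mappingTorus_sectionCircleNbhd)
    (hS : exists_isOpenGluing_circleSurgeryRel.{0}) : exists_isCappellShanesonSphereOf := by
  intro A hA
  obtain ⟨T, _, _, _, _, _, _, jA, jB, hG, c, hc, hrange, ⟨ν⟩⟩ := hT A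
  obtain ⟨P, _, _, _, _, _, _, hP⟩ := hS ν
  exact ⟨P, ‹_›, ‹_›, ‹_›, ‹_›, ‹_›, ‹_›, hA, T, ‹_›, ‹_›, ‹_›, ‹_›, ‹_›, ‹_›, jA, jB, hG, c, hc,
    hrange, ν, hP⟩

/-- **Circle surgery from a tubular neighbourhood.** The named fact `exists_isCircleSurgery`
(existence of surgery on a smoothly embedded circle in a closed *orientable* 4-manifold) follows
from the existence of tubular neighbourhoods (`nonempty_circleNbhd`, where orientability enters)
and surgery along a given tubular neighbourhood (`exists_isOpenGluing_circleSurgeryRel`)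
(Gompf–Stipsicz (1999), §5.2). [cite: GompfStipsicz1999, §5.2] -/
theorem exists_isCircleSurgery_of (hN : nonempty_circleNbhd.{u})
    (hS : exists_isOpenGluing_circleSurgeryRel.{u}) : exists_isCircleSurgery.{u} := by
  intro X _ _ _ _ _ _ hX c hc
  obtain ⟨ν⟩ := hN hX c hc
  obtain ⟨P, _, _, _, _, _, _, hP⟩ := hS ν
  exact ⟨P, ‹_›, ‹_›, ‹_›, ‹_›, ‹_›, ‹_›, ν, hP⟩

/-! ### Discharges of the two halves and of `exists_isCappellShanesonSphereOf` (D-0014) -/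

/-- **The input of the surgery exists** — discharge of `exists_mappingTorus_sectionCircleNbhd`:
for every `A ∈ SL(3, ℤ)` the glued mapping torus `CSTorus A` of `torusDiffeomorph A`, its section
circle `sectionCircle A γ` through the fixed point `1 ∈ T³` and the tubular neighbourhood
`sectionCircleNbhd A γ` (built in `Literature.Topology.FourManifolds.SectionCircleNbhd` from a
smooth path `γ` from `1` to `A` in `GL(3, ℝ)`, i.e. a trivialisation of the normal bundle of the
section) witness the statement (`exists_mappingTorus_sectionCircleNbhd_witness`;
Cappell–Shaneson 1976, §2; Gompf 2010, §3). [cite: CappellShaneson1976, §2] -/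
theorem exists_mappingTorus_sectionCircleNbhd_holds : exists_mappingTorus_sectionCircleNbhd :=
  fun A ↦ exists_mappingTorus_sectionCircleNbhd_witness A

/-- **Surgery along a given tubular neighbourhood exists** — discharge of
`exists_isOpenGluing_circleSurgeryRel`: the surgered manifold is the pushout
`(X ∖ c) ∪_glue (D̊² × 𝕊²)` of `Literature.Topology.FourManifolds.CircleSurgeryExistence`
(`CircleNbhd.Surgered ν`, `CircleNbhd.surgery_exists`), a closed smooth 4-manifold which is an
open gluing along `circleSurgeryRel ν` (Gompf–Stipsicz (1999), §5.2). [cite: GompfStipsicz1999, §5.2] -/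
theorem exists_isOpenGluing_circleSurgeryRel_holds : exists_isOpenGluing_circleSurgeryRel.{u} := by
  intro X _ _ _ _ _ _ c ν
  exact ν.surgery_exists

/-- **Existence of Cappell–Shaneson spheres** — discharge of the named fact
`Literature.Topology.FourManifolds.exists_isCappellShanesonSphereOf` of `Literature.Topology.FourManifolds.CircleSurgery`: for
every `A ∈ SL(3, ℤ)` with `det (A - 1) = ±1` there is a closed smooth 4-manifold `X` with
`IsCappellShanesonSphereOf A X`, namely the surgery (`exists_isOpenGluing_circleSurgeryRel_holds`)
on the section circle of the mapping torus of `torusDiffeomorph A`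
(`exists_mappingTorus_sectionCircleNbhd_holds`), assembled by `exists_isCappellShanesonSphereOf_of`
(Cappell–Shaneson, *Some new four-manifolds*, Ann. of Math. 104 (1976), §2: the manifolds obtained
from the mapping torus of `A` acting on `T³` by surgery on the section circle; Gompf, Algebr. Geom.
Topol. 10 (2010), §2). [cite: CappellShaneson1976, §2 (construction of the Cappell–Shaneson spheres)] -/
theorem exists_isCappellShanesonSphereOf_holds : exists_isCappellShanesonSphereOf :=
  exists_isCappellShanesonSphereOf_of exists_mappingTorus_sectionCircleNbhd_holds
    exists_isOpenGluing_circleSurgeryRel_holds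

/-! ### Uniqueness of circle surgery along a fixed tubular neighbourhood (D-0014 discharge) -/

/-- **Discharge of `nonempty_diffeomorph_of_isCircleSurgery_of_eq` (uniqueness of circle surgery
for a fixed tubular neighbourhood).** Two open gluings `P`, `P'` of `X ∖ c(𝕊¹)` and `D̊² × 𝕊²`
along the *same* relation `circleSurgeryRel ν` are open gluings of the same pieces along the same
relation, hence diffeomorphic by the uniqueness of open gluings `IsOpenGluing.nonempty_diffeomorph`
(`Literature.Topology.FourManifolds.GluingUniqueness`): the comparison map `jA a ↦ jA' a`,
`jB b ↦ jB' b` is a well defined bijection (both gluings realise the same identifications and the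
gluing maps are injective), smooth in both directions by descent of smoothness along the open
smooth embeddings `jA`, `jB` (`contMDiffAt_of_comp_isImmersionAt`). This is Kosinski's remark
that an identification space `A ∪_g B` carries "the unique structure for which the projections
are diffeomorphisms" onto their open images (Kosinski, *Differential Manifolds* (1993), Ch. VI §1,
proof of Theorem (1.1)), applied to the surgery `(X ∖ ν(𝕊¹ × B³)) ∪_{𝕊¹ × 𝕊²} (D² × 𝕊²)` of
Gompf–Stipsicz (1999), §5.2. Of the fact's hypotheses only `IsManifold IP ∞ P` and
`IsManifold IP' ∞ P'` are used (the preferred charts of `P`, `P'` must lie in the maximal `C^∞`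
atlases); `IsManifold IX ∞ X` and `FiniteDimensional ℝ EP` play no role. [cite: Kosinski1993, Ch. VI §1, proof of Thm (1.1)] [cite: GompfStipsicz1999, §5.2] -/
theorem nonempty_diffeomorph_of_isCircleSurgery_of_eq_holds :
    nonempty_diffeomorph_of_isCircleSurgery_of_eq := by
  intro EX HX _ _ _ IX X _ _ _ _ EP HP _ _ _ _ IP P _ _ _ HP' _ IP' P' _ _ _ c ν h h'
  exact IsOpenGluing.nonempty_diffeomorph h h'

/-! ### Existence of circle surgery (D-0014 discharge of `exists_isCircleSurgery`) -/

/-- **Discharge of `Literature.Topology.FourManifolds.exists_isCircleSurgery` (existence of surgery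
on an embedded circle in a closed orientable 4-manifold).** For a `C^∞` embedding `c : 𝕊¹ → X`
into a closed (compact, Hausdorff, second countable) orientable `C^∞` 4-manifold there is a closed
`C^∞` 4-manifold `P` with `IsCircleSurgery (𝓡 4) (𝓡 4) X P c`: the normal bundle of `c` is trivial
because `X` is orientable, so `c` has a tubular neighbourhood `ν : 𝕊¹ × ℝ³ ↪ X`
(`nonempty_circleNbhd_of_compactSpace`, `Literature.Topology.FourManifolds.CircleNormalFraming`:
Whitney embedding, two normal fields in general position, the third from the orientation, and the
tubular neighbourhood theorem for framed circles), and the surgered manifold is the pushout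
`(X ∖ c(𝕊¹)) ∪_{circleSurgeryRel ν} (D̊² × 𝕊²)` (`exists_isOpenGluing_circleSurgeryRel_holds`),
assembled by `exists_isCircleSurgery_of` with the compact case of `nonempty_circleNbhd` inlined.
This is surgery on a `0`-sphere bundle's base circle in the sense of Kosinski, *Differential
Manifolds* (1993), VI.9 ("Surgery on a `(λ-1)`-sphere `S` in a manifold `M^m` …
`χ(M, S) = (M - S) ∪_{hα} (S^m - S^{λ-1})`", with VI.5: "`S` must have a trivial normal bundle",
and VI.6: "the only orientable disc bundle over the circle is the product bundle"), i.e. the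
operation `𝕊¹ × B³ ↦ D² × 𝕊²` of Gompf–Stipsicz, *4-Manifolds and Kirby Calculus* (1999), §5.2.
[cite: GompfStipsicz1999, §5.2 (surgery on an embedded circle in a 4-manifold)] -/
theorem exists_isCircleSurgery_holds : exists_isCircleSurgery.{u} := by
  intro X _ _ _ _ _ _ hX c hc
  obtain ⟨ν⟩ := nonempty_circleNbhd_of_compactSpace hX c hc
  obtain ⟨P, _, _, _, _, _, _, hP⟩ := exists_isOpenGluing_circleSurgeryRel_holds ν
  exact ⟨P, ‹_›, ‹_›, ‹_›, ‹_›, ‹_›, ‹_›, ν, hP⟩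

/-! ### Tubular neighbourhoods of embedded circles (D-0014 discharge of `nonempty_circleNbhd`) -/

/-- **Discharge of `Literature.Topology.FourManifolds.nonempty_circleNbhd` (tubular neighbourhoods of
embedded circles in orientable 4-manifolds, no compactness assumed).** A smoothly embedded circle
`c : 𝕊¹ → X` in an orientable `C^∞` 4-manifold `X` (Hausdorff, second countable, charted on `ℝ⁴`)
has an open tubular neighbourhood `𝕊¹ × ℝ³ ↪ X` (`CircleNbhd (𝓡 4) c`): its normal bundle is
framed (`exists_normalFraming_of_isOrientable_holds`, `NormalFramingOfCircle.lean`: a frame of the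
velocity is walked along the circle chart by chart and closed up through `GL⁺(3, ℝ)`, the
orientation of `X` making the two end frames agree in orientation — Hirsch, *Differential
Topology* (1976), Ch. 4 §4, Exercise 2: an orientable vector bundle over `S¹` is trivial), and a
normal framing yields a tubular neighbourhood (`nonempty_circleNbhd_of_framing`,
`CircleNbhdOfFraming.lean`: Kosinski, *Differential Manifolds* (1993), III, Thm. 2.2 and
Cor. 2.3). The compact case was obtained independently through a Whitney embedding in
`CircleNormalFraming.lean` (`nonempty_circleNbhd_of_compactSpace`); the present theorem is the fact
as stated, for all orientable `X`. This is the neighbourhood `S¹ × D³` of an embedded circle used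
for surgery in Gompf–Stipsicz, *4-Manifolds and Kirby Calculus* (1999), §5.2, and Kosinski, VI.6
(before Cor. 6.6: "the only orientable disc bundle over the circle is the product bundle").
[cite: HirschDT1976, Ch. 4 §4, Exercise 2 (p. 108)] -/
theorem nonempty_circleNbhd_holds : nonempty_circleNbhd.{u} :=
  nonempty_circleNbhd_of_framing exists_normalFraming_of_isOrientable_holds

end Literature.Topology.FourManifolds
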